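import Mathlib
import Summits.KontsevichZagierPeriods.Zeta5Search.CatalanQSum
import HarnessLib

/-!
# Catalan box family — PROOF of the exact 2-adic law F2♯ for the `G`-coefficient (`CatalanQSum.TwoAdicLaw`)

HONEST FRAMING: systematic search; no irrationality claim unless certified.

Cell `pub-zeta5`, prover seat p3 (gen 2), for the `fam-catalan` / `fam-denom` lanes.  `theorem twoAdicLaw_holds : TwoAdicLaw`:
for ALL `H, J, K, L, M` on the box (only `H ≤ K + L` is used),
`v₂(catalanQ H J K L M) = 3 − 2(S + C) + s₂(S) + s₂(C)`, `S = J+K−M`, `C = K+L−H`, `s₂` = binary digit sum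
— fam-catalan's F2♯ (Q-half; `families/catalan/QSUM.md` §5.1, proved there on paper in the Pochhammer regrouping; here proved
directly on the tree's `₃F₂` evaluator `f32Aux`).  Nothing here is a statement about Catalan's constant.

PROOF.  (1) A half-integer `x + ½` (`x ∈ ℤ`) is `odd/2`, so `v₂ = −1`; hence `v₂((x+½)_n) = −n` (`padicValRat_poch_half`) and
`v₂(g(r)) = r` for the tree's `gammaHalfRatio` (`padicValRat_gammaHalfRatio`).  (2) The `i`-th term `t_i` of the evaluator of
`₃F₂(−J, −C, x+½; y+½, z+½; 1)` satisfies `t_{i+1} = t_i·(i−J)(i−C)(x+½+i)/((i+1)(y+½+i)(z+½+i))`, whence for `i ≤ min(J,C)`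
`v₂(t_i) = i + [v₂(J!) − v₂((J−i)!) − v₂(i!)] + [v₂(C!) − v₂((C−i)!)] = i + v₂ C(J,i) + v₂(C!/(C−i)!) ≥ i` (`f32Aux_fst_val`);
so every term after `t_0 = 1` has POSITIVE valuation and, by the ultrametric inequality (`padicValRat.sum_pos_of_pos`,
`padicValRat.add_eq_of_lt`), `v₂(₃F₂) = 0` (`padicValRat_f32`).  (3) Multiply out the prefactor `8(−1)^{…}(½)_H(½)_K g(H−L)g(H−S)/(S!C!)`
with LEGENDRE `v₂(n!) = n − s₂(n)` (`sub_one_mul_padicValNat_factorial`): `3 − H − K + (H−L) + (H−S) − (S − s₂S) − (C − s₂C)`, which is the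
claim because `C = K + L − H`.
-/

open Finset

namespace Summit.KontsevichZagierPeriods.Zeta5Search.CatalanQSum

/-! ### Half-integers and their Pochhammers, 2-adically -/

/-- A half-integer `x + ½` is non-zero. -/
theorem intCast_add_half_ne_zero (x : ℤ) : (x : ℚ) + 1 / 2 ≠ 0 := by
  intro h
  have h2 : ((2 * x + 1 : ℤ) : ℚ) = 0 := by push_cast; linarith
  have h3 : (2 * x + 1 : ℤ) = 0 := by exact_mod_cast h2
  omega

/-- A half-integer `x + ½ = (2x+1)/2` has `v₂ = −1`. -/
theorem padicValRat_intCast_add_half (x : ℤ) : padicValRat 2 ((x : ℚ) + 1 / 2) = -1 := by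
  have h : ((x : ℚ) + 1 / 2) = ((2 * x + 1 : ℤ) : ℚ) / 2 := by push_cast; ring
  have hodd : (2 * x + 1 : ℤ) ≠ 0 := by omega
  have h2 : padicValRat 2 (2 : ℚ) = 1 := by simpa using padicValRat.self (p := 2) one_lt_two
  rw [h, padicValRat.div (by exact_mod_cast hodd) two_ne_zero, padicValRat.of_int,
    padicValInt.eq_zero_of_not_dvd (by omega), h2]
  norm_num

/-- `(x + ½)_n ≠ 0` for an integer `x`. -/
theorem poch_half_ne_zero (x : ℤ) (n : ℕ) : poch ((x : ℚ) + 1 / 2) n ≠ 0 := by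
  induction n with
  | zero => simp [poch]
  | succ n ih =>
    rw [poch, show (x : ℚ) + 1 / 2 + (n : ℕ) = ((x + n : ℤ) : ℚ) + 1 / 2 by push_cast; ring]
    exact mul_ne_zero ih (intCast_add_half_ne_zero _)

/-- `v₂((x + ½)_n) = −n` for an integer `x`: each factor is an odd integer over `2`. -/
theorem padicValRat_poch_half (x : ℤ) (n : ℕ) : padicValRat 2 (poch ((x : ℚ) + 1 / 2) n) = -(n : ℤ) := by
  induction n with
  | zero => simp [poch]
  | succ n ih =>
    rw [poch, show (x : ℚ) + 1 / 2 + (n : ℕ) = ((x + n : ℤ) : ℚ) + 1 / 2 by push_cast; ring,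
      padicValRat.mul (poch_half_ne_zero x n) (intCast_add_half_ne_zero _), ih, padicValRat_intCast_add_half]
    push_cast
    ring

/-- `(½)_n ≠ 0`. -/
theorem poch_oneHalf_ne_zero (n : ℕ) : poch (1 / 2) n ≠ 0 := by
  have h := poch_half_ne_zero 0 n
  simpa using h

/-- `v₂((½)_n) = −n`. -/
theorem padicValRat_poch_oneHalf (n : ℕ) : padicValRat 2 (poch (1 / 2) n) = -(n : ℤ) := by
  have h := padicValRat_poch_half 0 n
  simpa using h

/-- `g(r) = Γ(½)/Γ(r+½) ≠ 0`. -/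
theorem gammaHalfRatio_ne_zero (r : ℤ) : gammaHalfRatio r ≠ 0 := by
  unfold gammaHalfRatio
  split_ifs
  · exact inv_ne_zero (poch_oneHalf_ne_zero _)
  · exact mul_ne_zero (pow_ne_zero _ (by norm_num)) (poch_oneHalf_ne_zero _)

/-- `v₂(g(r)) = r` for every integer `r`. -/
theorem padicValRat_gammaHalfRatio (r : ℤ) : padicValRat 2 (gammaHalfRatio r) = r := by
  unfold gammaHalfRatio
  split_ifs with h
  · rw [padicValRat.inv, padicValRat_poch_oneHalf, neg_neg, Int.toNat_of_nonneg h]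
  · rw [padicValRat.mul (pow_ne_zero _ (by norm_num)) (poch_oneHalf_ne_zero _), padicValRat.pow,
      padicValRat.neg, padicValRat.one, mul_zero, zero_add, padicValRat_poch_oneHalf,
      Int.toNat_of_nonneg (by omega), neg_neg]

/-! ### The terminating `₃F₂` evaluator, 2-adically -/

/-- One step of the term recursion. -/
theorem f32Aux_fst_succ (J C : ℕ) (a b₁ b₂ : ℚ) (i : ℕ) :
    (f32Aux J C a b₁ b₂ (i + 1)).1 = (f32Aux J C a b₁ b₂ i).1 *
      ((((i : ℚ) - J) * ((i : ℚ) - C) * (a + i)) / (((i : ℚ) + 1) * (b₁ + i) * (b₂ + i))) := by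
  simp only [f32Aux]
  ring

/-- One step of the partial-sum recursion. -/
theorem f32Aux_snd_succ (J C : ℕ) (a b₁ b₂ : ℚ) (i : ℕ) :
    (f32Aux J C a b₁ b₂ (i + 1)).2 = (f32Aux J C a b₁ b₂ i).2 + (f32Aux J C a b₁ b₂ (i + 1)).1 := by
  simp only [f32Aux]

/-- The partial sum is `1 +` the sum of the later terms. -/
theorem f32Aux_snd_eq (J C : ℕ) (a b₁ b₂ : ℚ) (n : ℕ) :
    (f32Aux J C a b₁ b₂ n).2 = 1 + ∑ i ∈ range n, (f32Aux J C a b₁ b₂ (i + 1)).1 := by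
  induction n with
  | zero => simp [f32Aux]
  | succ n ih => rw [f32Aux_snd_succ, ih, Finset.sum_range_succ, add_assoc]

/-- `v₂(n!) = v₂((n−j)!) + v₂((j)! ) + v₂(C(n,j))`-type bookkeeping: `v₂(n!) = v₂(C(n,j)) + v₂(j!) + v₂((n−j)!)`. -/
theorem padicValNat_factorial_eq_choose (n j : ℕ) (h : j ≤ n) :
    padicValNat 2 (n.factorial) = padicValNat 2 (n.choose j) + padicValNat 2 (j.factorial)
      + padicValNat 2 ((n - j).factorial) := by
  rw [← Nat.choose_mul_factorial_mul_factorial h,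
    padicValNat.mul (mul_ne_zero (Nat.choose_pos h).ne' (Nat.factorial_ne_zero _)) (Nat.factorial_ne_zero _),
    padicValNat.mul (Nat.choose_pos h).ne' (Nat.factorial_ne_zero _)]

/-- **The terms of `₃F₂(−J, −C, x+½; y+½, z+½; 1)`**: for `i ≤ min(J, C)` the `i`-th term is non-zero and
`v₂(t_i) = i + v₂(J!) − v₂((J−i)!) + v₂(C!) − v₂((C−i)!) − v₂(i!)`. -/
theorem f32Aux_fst_val (J C : ℕ) (x y z : ℤ) (i : ℕ) (hiJ : i ≤ J) (hiC : i ≤ C) :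
    (f32Aux J C ((x : ℚ) + 1 / 2) ((y : ℚ) + 1 / 2) ((z : ℚ) + 1 / 2) i).1 ≠ 0 ∧
    padicValRat 2 (f32Aux J C ((x : ℚ) + 1 / 2) ((y : ℚ) + 1 / 2) ((z : ℚ) + 1 / 2) i).1
      = (i : ℤ) + (padicValNat 2 J.factorial : ℤ) - padicValNat 2 (J - i).factorial
        + padicValNat 2 C.factorial - padicValNat 2 (C - i).factorial - padicValNat 2 i.factorial := by
  induction i with
  | zero => simp [f32Aux]
  | succ i ih =>
    obtain ⟨hne, hval⟩ := ih (by omega) (by omega)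
    rw [f32Aux_fst_succ]
    have hJ : ((i : ℚ) - J) = -(((J - i : ℕ) : ℚ)) := by push_cast [Nat.cast_sub (by omega : i ≤ J)]; ring
    have hC : ((i : ℚ) - C) = -(((C - i : ℕ) : ℚ)) := by push_cast [Nat.cast_sub (by omega : i ≤ C)]; ring
    have ha : ((x : ℚ) + 1 / 2 + i) = ((x + i : ℤ) : ℚ) + 1 / 2 := by push_cast; ring
    have hb1 : ((y : ℚ) + 1 / 2 + i) = ((y + i : ℤ) : ℚ) + 1 / 2 := by push_cast; ring
    have hb2 : ((z : ℚ) + 1 / 2 + i) = ((z + i : ℤ) : ℚ) + 1 / 2 := by push_cast; ring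
    have hi1 : ((i : ℚ) + 1) = ((i + 1 : ℕ) : ℚ) := by push_cast; ring
    have hJi : (J - i : ℕ) ≠ 0 := by omega
    have hCi : (C - i : ℕ) ≠ 0 := by omega
    rw [hJ, hC, ha, hb1, hb2, hi1]
    have hJq : (((J - i : ℕ) : ℚ)) ≠ 0 := by exact_mod_cast hJi
    have hCq : (((C - i : ℕ) : ℚ)) ≠ 0 := by exact_mod_cast hCi
    have hiq : (((i + 1 : ℕ) : ℚ)) ≠ 0 := by exact_mod_cast Nat.succ_ne_zero i
    have hnum : -((J - i : ℕ) : ℚ) * -((C - i : ℕ) : ℚ) * (((x + i : ℤ) : ℚ) + 1 / 2) ≠ 0 :=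
      mul_ne_zero (mul_ne_zero (neg_ne_zero.2 hJq) (neg_ne_zero.2 hCq)) (intCast_add_half_ne_zero _)
    have hden : ((i + 1 : ℕ) : ℚ) * (((y + i : ℤ) : ℚ) + 1 / 2) * (((z + i : ℤ) : ℚ) + 1 / 2) ≠ 0 :=
      mul_ne_zero (mul_ne_zero hiq (intCast_add_half_ne_zero _)) (intCast_add_half_ne_zero _)
    refine ⟨mul_ne_zero hne (div_ne_zero hnum hden), ?_⟩
    rw [padicValRat.mul hne (div_ne_zero hnum hden), hval, padicValRat.div hnum hden,
      padicValRat.mul (mul_ne_zero (neg_ne_zero.2 hJq) (neg_ne_zero.2 hCq)) (intCast_add_half_ne_zero _),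
      padicValRat.mul (neg_ne_zero.2 hJq) (neg_ne_zero.2 hCq),
      padicValRat.mul (mul_ne_zero hiq (intCast_add_half_ne_zero _)) (intCast_add_half_ne_zero _),
      padicValRat.mul hiq (intCast_add_half_ne_zero _), padicValRat.neg, padicValRat.neg,
      padicValRat.of_nat, padicValRat.of_nat, padicValRat.of_nat, padicValRat_intCast_add_half,
      padicValRat_intCast_add_half, padicValRat_intCast_add_half]
    -- factorial bookkeeping
    have e1 : padicValNat 2 (J - i).factorial = padicValNat 2 (J - i) + padicValNat 2 (J - (i + 1)).factorial := by
      rw [show J - i = (J - (i + 1)) + 1 by omega, Nat.factorial_succ,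
        padicValNat.mul (by omega) (Nat.factorial_ne_zero _)]
    have e2 : padicValNat 2 (C - i).factorial = padicValNat 2 (C - i) + padicValNat 2 (C - (i + 1)).factorial := by
      rw [show C - i = (C - (i + 1)) + 1 by omega, Nat.factorial_succ,
        padicValNat.mul (by omega) (Nat.factorial_ne_zero _)]
    have e3 : padicValNat 2 (i + 1).factorial = padicValNat 2 (i + 1) + padicValNat 2 i.factorial := by
      rw [Nat.factorial_succ, padicValNat.mul (Nat.succ_ne_zero i) (Nat.factorial_ne_zero _)]
    rw [e1, e2, e3]
    push_cast
    ring

/-- **`v₂(₃F₂(−J, −C, x+½; y+½, z+½; 1)) = 0`** (and the sum is non-zero): the constant term `1` is the unique term of minimal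
2-adic valuation. -/
theorem padicValRat_f32 (J C : ℕ) (x y z : ℤ) :
    f32 J C ((x : ℚ) + 1 / 2) ((y : ℚ) + 1 / 2) ((z : ℚ) + 1 / 2) ≠ 0 ∧
    padicValRat 2 (f32 J C ((x : ℚ) + 1 / 2) ((y : ℚ) + 1 / 2) ((z : ℚ) + 1 / 2)) = 0 := by
  unfold f32
  rw [f32Aux_snd_eq]
  set R := ∑ i ∈ range (min J C), (f32Aux J C ((x : ℚ) + 1 / 2) ((y : ℚ) + 1 / 2) ((z : ℚ) + 1 / 2) (i + 1)).1
    with hR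
  by_cases hR0 : R = 0
  · rw [hR0, add_zero]
    exact ⟨one_ne_zero, padicValRat.one⟩
  · have hRpos : 0 < padicValRat 2 R := by
      refine padicValRat.sum_pos_of_pos (fun i hi => ?_) hR0
      have hiJ : i + 1 ≤ J := by have := min_le_left J C; omega
      have hiC : i + 1 ≤ C := by have := min_le_right J C; omega
      rw [(f32Aux_fst_val J C x y z (i + 1) hiJ hiC).2, padicValNat_factorial_eq_choose J (i + 1) hiJ,
        padicValNat_factorial_eq_choose C (i + 1) hiC]
      omega
    have h1R : (1 : ℚ) + R ≠ 0 := by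
      intro h
      have hR1 : R = -1 := by linarith
      rw [hR1, padicValRat.neg, padicValRat.one] at hRpos
      exact lt_irrefl _ hRpos
    refine ⟨h1R, ?_⟩
    rw [padicValRat.add_eq_of_lt h1R one_ne_zero hR0 (by rwa [padicValRat.one]), padicValRat.one]

/-! ### Legendre and the theorem -/

/-- Legendre at `p = 2`: `v₂(n!) = n − s₂(n)`. -/
theorem padicValNat_two_factorial (n : ℕ) : (padicValNat 2 n.factorial : ℤ) = n - ((Nat.digits 2 n).sum : ℤ) := by
  have h := sub_one_mul_padicValNat_factorial (p := 2) n
  norm_num at h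
  have hle := Nat.digit_sum_le 2 n
  omega

/-- `v₂(8) = 3`. -/
theorem padicValRat_two_eight : padicValRat 2 (8 : ℚ) = 3 := by
  have h2 : padicValRat 2 (2 : ℚ) = 1 := by simpa using padicValRat.self (p := 2) one_lt_two
  rw [show (8 : ℚ) = (2 : ℚ) ^ 3 by norm_num, padicValRat.pow, h2]
  norm_num

/-- **F2♯ (Q-half) holds**: `v₂(catalanQ H J K L M) = 3 − 2(S+C) + s₂(S) + s₂(C)` on the whole box. -/
theorem twoAdicLaw_holds : TwoAdicLaw := by
  intro H J K L M hH _ _ _ _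
  -- the factors of `catalanQ`
  have ha : ((H : ℚ) + 1 / 2) = ((H : ℤ) : ℚ) + 1 / 2 := by push_cast; ring
  have hb1 : ((H : ℚ) - L + 1 / 2) = (((H : ℤ) - L : ℤ) : ℚ) + 1 / 2 := by push_cast; ring
  have hb2 : ((H : ℚ) - ((J + K - M : ℕ) : ℚ) + 1 / 2) = (((H : ℤ) - ((J + K - M : ℕ) : ℤ) : ℤ) : ℚ) + 1 / 2 := by
    push_cast; ring
  obtain ⟨hF, hFv⟩ := padicValRat_f32 J (K + L - H) (H : ℤ) ((H : ℤ) - L) ((H : ℤ) - ((J + K - M : ℕ) : ℤ))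
  rw [← ha, ← hb1, ← hb2] at hF hFv
  have h8 : (8 : ℚ) ≠ 0 := by norm_num
  have hsgn : ((-1 : ℚ) ^ (H + L + (J + K - M))) ≠ 0 := pow_ne_zero _ (by norm_num)
  have hpH := poch_oneHalf_ne_zero H
  have hpK := poch_oneHalf_ne_zero K
  have hg1 := gammaHalfRatio_ne_zero ((H : ℤ) - L)
  have hg2 := gammaHalfRatio_ne_zero ((H : ℤ) - ((J + K - M : ℕ) : ℤ))
  have hfS : (((J + K - M).factorial : ℕ) : ℚ) ≠ 0 := by exact_mod_cast Nat.factorial_ne_zero _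
  have hfC : (((K + L - H).factorial : ℕ) : ℚ) ≠ 0 := by exact_mod_cast Nat.factorial_ne_zero _
  have h1 := mul_ne_zero h8 hsgn
  have h2 := mul_ne_zero h1 hpH
  have h3 := mul_ne_zero h2 hpK
  have h4 := mul_ne_zero h3 hg1
  have h5 := mul_ne_zero h4 hg2
  have h6 := div_ne_zero h5 (mul_ne_zero hfS hfC)
  change padicValRat 2 (8 * (-1) ^ (H + L + (J + K - M)) * poch (1 / 2) H * poch (1 / 2) K
      * gammaHalfRatio ((H : ℤ) - L) * gammaHalfRatio ((H : ℤ) - ((J + K - M : ℕ) : ℤ))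
      / ((((J + K - M).factorial : ℕ) : ℚ) * (((K + L - H).factorial : ℕ) : ℚ))
      * f32 J (K + L - H) ((H : ℚ) + 1 / 2) ((H : ℚ) - L + 1 / 2) ((H : ℚ) - ((J + K - M : ℕ) : ℚ) + 1 / 2)) = _
  rw [padicValRat.mul h6 hF, padicValRat.div h5 (mul_ne_zero hfS hfC), padicValRat.mul h4 hg2,
    padicValRat.mul h3 hg1, padicValRat.mul h2 hpK, padicValRat.mul h1 hpH, padicValRat.mul h8 hsgn,
    padicValRat.mul hfS hfC, hFv, padicValRat_two_eight, padicValRat.pow, padicValRat.neg, padicValRat.one, mul_zero,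
    padicValRat_poch_oneHalf, padicValRat_poch_oneHalf, padicValRat_gammaHalfRatio, padicValRat_gammaHalfRatio,
    padicValRat.of_nat, padicValRat.of_nat, padicValNat_two_factorial, padicValNat_two_factorial]
  push_cast
  omega

end Summit.KontsevichZagierPeriods.Zeta5Search.CatalanQSum
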